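import Literature.AlgebraicGeometry.Frobenioids.FrobenioidNatIso
import HarnessLib

/-!
# Frobenioids I: the object types of Definition 1.2 (iv)(v) under an isomorphism of structure functors

Mochizuki, *The geometry of Frobenioids I: the general theory*, Kyushu J. Math. **62** (2008)
293–400, §1, Definition 1.2 (iv) (Frobenius-trivial, metrically trivial, base-trivial, `Aut`-ample,
perfect, group-like, Frobenius-normalized, unit-trivial, isotropic objects) and (v) ("of …-type"),
kurims pp. 23–24 [cite: MochizukiFrdI2008, Def. 1.2(iv) p.23].

Companion of `FrobenioidNatIso.lean` (the arrow notions) and `FrobenioidNatIsoTransport.lean`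
(Def. 1.3): for an isomorphism `e : F ≅ F'` of structure functors `C → F_Φ`, the object types of
Def. 1.2 (iv) coincide for `F` and `F'`, hence so do the "of …-type" conditions of Def. 1.2 (v) — in
particular the standing hypotheses "of Frobenius-normalized, metrically trivial and `Aut`-ample type"
of [FrdI] Prop. 2.5 / Cor. 2.6 transport along `e` (`isOfType_iff`).  `Aut`-ampleness: the base
automorphisms of `A` for `F'` are the `b_A`-conjugates of those for `F`.  Proof-only, no definitions;
tooling (GAP row G-L6t9-1).
-/

namespace Literature.AlgebraicGeometry.Frobenioids

open CategoryTheory Opposite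

universe w v v' u u'

namespace PreFrobenioid

namespace StructureIso

variable {D : Type u} [Category.{v} D] {Φ : Dᵒᵖ ⥤ CommMonCat.{w}}
  {C : Type u'} [Category.{v'} C] {F F' : C ⥤ ElemFrobenioid Φ} (e : F ≅ F')

include e

/-- Metrically trivial for `F'` iff for `F`. [cite: MochizukiFrdI2008, Def. 1.2(iv) p.23] -/
theorem isMetricallyTrivial_iff (hΦ : ∀ A : D, IsSharp (Φ.obj (op A))) (A : C) :
    IsMetricallyTrivial F' A ↔ IsMetricallyTrivial F A := by
  unfold IsMetricallyTrivial
  simp only [isCoAngular_iff e hΦ, isPreStep_iff e]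

/-- Base-trivial for `F'` iff for `F`. [cite: MochizukiFrdI2008, Def. 1.2(iv) p.23] -/
theorem isBaseTrivial_iff (A : C) : IsBaseTrivial F' A ↔ IsBaseTrivial F A := by
  unfold IsBaseTrivial
  simp only [baseIsomorphic_iff e]

/-- Unit-trivial for `F'` iff for `F`. [cite: MochizukiFrdI2008, Def. 1.2(iv) p.23] -/
theorem isUnitTrivial_iff (A : C) : IsUnitTrivial F' A ↔ IsUnitTrivial F A := by
  unfold IsUnitTrivial
  rw [unitsSubgroup_eq e]

/-- Group-like for `F'` iff for `F` (`Φ(A'_D) ≅ Φ(A_D)` along `b_A`).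
[cite: MochizukiFrdI2008, Def. 1.2(iv) p.23] -/
theorem isGroupLikeObj_iff (A : C) : IsGroupLikeObj F' A ↔ IsGroupLikeObj F A := by
  haveI := isIso_base_hom_app e A
  haveI := isIso_base_inv_app e A
  constructor
  · intro h x
    have hx := h (pull Φ (ElemFrobenioid.Base (e.inv.app A)) x)
    have := congrArg (pull Φ (ElemFrobenioid.Base (e.hom.app A))) hx
    rwa [pull_hom_pull_inv e, map_one] at this
  · intro h x
    have hx := h (pull Φ (ElemFrobenioid.Base (e.hom.app A)) x)
    have := congrArg (pull Φ (ElemFrobenioid.Base (e.inv.app A))) hx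
    rwa [pull_inv_pull_hom e, map_one] at this

/-- Frobenius-normalized for `F'` iff for `F` (same `O^▷(A)`, same base-identity endomorphisms, same
Frobenius degrees). [cite: MochizukiFrdI2008, Def. 1.2(iv) p.24] -/
theorem isFrobeniusNormalized_iff (A : C) : IsFrobeniusNormalized F' A ↔ IsFrobeniusNormalized F A := by
  constructor
  · intro h φ hφ α hα
    have h' := h φ ((isBaseIdentity_iff e φ).mpr hφ) α ((endSubmonoid_eq e A).symm ▸ hα)
    rwa [degFr_eq e] at h'
  · intro h φ hφ α hα
    have h' := h φ ((isBaseIdentity_iff e φ).mp hφ) α ((endSubmonoid_eq e A) ▸ hα)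
    rwa [← degFr_eq e] at h'

/-- `Aut`-ample for `F'` iff for `F`: `Aut_C(A) → Aut_D(A'_D)` is `Aut_C(A) → Aut_D(A_D)` followed by
the conjugation bijection `f ↦ b_A⁻¹ f b_A`. [cite: MochizukiFrdI2008, Def. 1.2(iv) p.23] -/
theorem isAutAmple_iff (A : C) : IsAutAmple F' A ↔ IsAutAmple F A := by
  let b : baseObj F A ≅ baseObj F' A := (ElemFrobenioid.baseFunctor Φ).mapIso (e.app A)
  let T : Aut (baseObj F A) ≃ Aut (baseObj F' A) :=
    { toFun := fun f => b.symm ≪≫ f ≪≫ b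
      invFun := fun g => b ≪≫ g ≪≫ b.symm
      left_inv := fun f => by ext; simp
      right_inv := fun g => by ext; simp }
  have hT : (fun α : Aut A => (baseFunctor F').mapIso α) = T ∘ fun α : Aut A => (baseFunctor F).mapIso α :=
    funext fun α => Iso.ext (base_eq e α.hom)
  unfold IsAutAmple
  rw [hT]
  exact Equiv.comp_surjective _ T

/-- Perfect for `F'` iff for `F` (every constituent notion coincides).
[cite: MochizukiFrdI2008, Def. 1.2(iv) p.23] -/
theorem isPerfectObj_iff (hΦ : ∀ A : D, IsSharp (Φ.obj (op A))) (A : C) :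
    IsPerfectObj F' A ↔ IsPerfectObj F A := by
  unfold IsPerfectObj
  simp only [baseIsomorphic_iff e, isFrobeniusType_iff e hΦ, degFr_eq e, isPreStep_iff e]

/-! ### Definition 1.2 (v): "of …-type" -/

/-- Of isotropic type for `F'` iff for `F`. [cite: MochizukiFrdI2008, Def. 1.2(v) p.24] -/
theorem isOfIsotropicType_iff (hΦ : ∀ A : D, IsSharp (Φ.obj (op A))) :
    IsOfIsotropicType F' ↔ IsOfIsotropicType F :=
  forall_congr' fun A => isIsotropic_iff e hΦ A

/-- Of perfect type for `F'` iff for `F`. [cite: MochizukiFrdI2008, Def. 1.2(v) p.24] -/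
theorem isOfPerfectType_iff (hΦ : ∀ A : D, IsSharp (Φ.obj (op A))) :
    IsOfPerfectType F' ↔ IsOfPerfectType F :=
  forall_congr' fun A => isPerfectObj_iff e hΦ A

/-- Of Frobenius-trivial type for `F'` iff for `F`. [cite: MochizukiFrdI2008, Def. 1.2(v) p.24] -/
theorem isOfFrobeniusTrivialType_iff (hΦ : ∀ A : D, IsSharp (Φ.obj (op A))) :
    IsOfFrobeniusTrivialType F' ↔ IsOfFrobeniusTrivialType F :=
  forall_congr' fun A => isFrobeniusTrivial_iff e hΦ A

/-- The standing hypotheses of [FrdI] Prop. 2.5 / Cor. 2.6 ("of Frobenius-normalized, metrically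
trivial and `Aut`-ample type") for `F'` iff for `F`. [cite: MochizukiFrdI2008, Prop. 2.5 p.48] -/
theorem isOfType_prop25_iff (hΦ : ∀ A : D, IsSharp (Φ.obj (op A))) :
    (IsOfType (IsFrobeniusNormalized F') ∧ IsOfType (IsMetricallyTrivial F') ∧ IsOfType (IsAutAmple F')) ↔
      (IsOfType (IsFrobeniusNormalized F) ∧ IsOfType (IsMetricallyTrivial F) ∧ IsOfType (IsAutAmple F)) :=
  and_congr (forall_congr' fun A => isFrobeniusNormalized_iff e A)
    (and_congr (forall_congr' fun A => isMetricallyTrivial_iff e hΦ A)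
      (forall_congr' fun A => isAutAmple_iff e A))

end StructureIso

end PreFrobenioid

end Literature.AlgebraicGeometry.Frobenioids
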